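import Mathlib
import HarnessLib

/-!
# The transport's inner product: `⟨𝓔S, 𝓔T⟩` on the window is `e^{a} Σ_{m,m′} ∫ S(mv) T(m′v) dv`

Helper file (`--supports stmt-RiemannHypothesis-0098`), one change of variables, no definitions.  Seat rh-explicit-weil-5 gen14
(file of record `HOME/rh-explicit-weil-5/WEIL5-CLASS.md` §1(c): the CLASS LADDER — rung `k` of a parity sector is the Gram–Schmidt
orthogonalisation, in THIS inner product, of the prolate class `{ψ_σ, ψ_{σ+4}, …}` inside `∫₀¹ S = 0`; it reproduces every measured interior,
ground and excited, to ≤ 0.3 %, and 108 blind nodes to ≤ 0.6 %).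

For dilates `m, m′ > 0` of seeds `S, T` transported to the window, `𝓔_m S(x) = e^{x/2} S(m e^{x−a})`, the `L²` pairing over any
`[x₀, x₁]` is, with `v = e^{x−a}` (`dx = dv/v`, `e^{x} = e^{a} v`):

* `transportPair_integrand_eq`   : pointwise, `(e^{x/2} S(m e^{x−a}))·(e^{x/2} T(m′ e^{x−a})) = e^{x−a} · (e^{a} S(m v) T(m′ v))|_{v = e^{x−a}}`;
* `integral_transportPair`        : `∫_{x₀}^{x₁} 𝓔_m S · 𝓔_{m′} T dx = e^{a} ∫_{e^{x₀−a}}^{e^{x₁−a}} S(m v) T(m′ v) dv`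
                                    (for `S∘(m·)`, `T∘(m′·)` continuous on the `v`-range);
* `integral_transportPair_window` : on `[-a, x₁]` the lower `v`-endpoint is `e^{−2a} = 1/μ`;
* `transportGram_sum`             : the finite double sum over `m, m′ ∈ [1, M]` of the pair integrals on a common range `[-a, x₁]` equals
                                    `e^{a} Σ_{m,m′} ∫_{1/μ}^{e^{x₁−a}} S(m v) T(m′ v) dv` — the Gram form used by the ladder (each dilate's
                                    cut-off `S(w) = 0, w > 1` is carried by the seed itself).

Standard axioms only; no `sorry`.
-/

set_option linter.dupNamespace false
set_option autoImplicit false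

noncomputable section

open Real intervalIntegral Set Finset

namespace Summit.RiemannHypothesis.RiemannHypothesis.Theorems.WeilTransportGram

/-- Pointwise form of the substitution `v = e^{x−a}` for a PRODUCT of two transported dilates:
`(e^{x/2} S(m e^{x−a}))(e^{x/2} T(m′ e^{x−a})) = e^{x−a} · (e^{a} · S(m e^{x−a}) · T(m′ e^{x−a}))`. -/
theorem transportPair_integrand_eq (S T : ℝ → ℝ) (a m m' x : ℝ) :
    (Real.exp (x / 2) * S (m * Real.exp (x - a))) * (Real.exp (x / 2) * T (m' * Real.exp (x - a)))
      = Real.exp (x - a) * (Real.exp a * S (m * Real.exp (x - a)) * T (m' * Real.exp (x - a))) := by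
  have h : Real.exp (x / 2) * Real.exp (x / 2) = Real.exp (x - a) * Real.exp a := by
    rw [← Real.exp_add, ← Real.exp_add]; congr 1; ring
  calc (Real.exp (x / 2) * S (m * Real.exp (x - a))) * (Real.exp (x / 2) * T (m' * Real.exp (x - a)))
      = (Real.exp (x / 2) * Real.exp (x / 2)) * (S (m * Real.exp (x - a)) * T (m' * Real.exp (x - a))) := by ring
    _ = (Real.exp (x - a) * Real.exp a) * (S (m * Real.exp (x - a)) * T (m' * Real.exp (x - a))) := by rw [h]
    _ = _ := by ring

/-- THE TRANSPORT PAIRING IS A PLAIN `dv` INTEGRAL: for seeds with `S∘(m·)`, `T∘(m′·)` continuous on the range `[e^{x₀−a}, e^{x₁−a}]`,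
`∫_{x₀}^{x₁} (e^{x/2}S(me^{x−a}))(e^{x/2}T(m′e^{x−a})) dx = e^{a} ∫_{e^{x₀−a}}^{e^{x₁−a}} S(mv) T(m′v) dv`. -/
theorem integral_transportPair (S T : ℝ → ℝ) (a m m' x₀ x₁ : ℝ)
    (hS : ContinuousOn (fun v => S (m * v)) (uIcc (Real.exp (x₀ - a)) (Real.exp (x₁ - a))))
    (hT : ContinuousOn (fun v => T (m' * v)) (uIcc (Real.exp (x₀ - a)) (Real.exp (x₁ - a)))) :
    ∫ x in x₀..x₁, (Real.exp (x / 2) * S (m * Real.exp (x - a))) * (Real.exp (x / 2) * T (m' * Real.exp (x - a)))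
      = Real.exp a * ∫ v in (Real.exp (x₀ - a))..(Real.exp (x₁ - a)), S (m * v) * T (m' * v) := by
  set f : ℝ → ℝ := fun x => Real.exp (x - a) with hf
  have hfd : ∀ x, HasDerivAt f (Real.exp (x - a)) x := by
    intro x
    have h1 : HasDerivAt (fun x : ℝ => x - a) 1 x := (hasDerivAt_id x).sub_const a
    have h2 : HasDerivAt (fun x : ℝ => Real.exp (x - a)) (Real.exp (x - a) * 1) x := (Real.hasDerivAt_exp _).comp x h1
    simpa using h2
  have hmono : Monotone f := fun x y hxy => Real.exp_le_exp.mpr (by linarith)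
  have himg : f '' uIcc x₀ x₁ ⊆ uIcc (f x₀) (f x₁) := hmono.image_uIcc_subset
  set g : ℝ → ℝ := fun v => Real.exp a * S (m * v) * T (m' * v) with hg
  have hgc : ContinuousOn g (f '' uIcc x₀ x₁) := by
    refine ContinuousOn.mono ?_ himg
    exact (continuousOn_const.mul hS).mul hT
  have key := intervalIntegral.integral_comp_mul_deriv' (f := f) (f' := fun x => Real.exp (x - a)) (g := g)
    (a := x₀) (b := x₁) (fun x _ => hfd x)
    ((Real.continuous_exp.comp (continuous_id.sub continuous_const)).continuousOn) hgc
  -- key : ∫ x in x₀..x₁, (g ∘ f) x * f' x = ∫ v in f x₀..f x₁, g v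
  have lhs : (fun x => (Real.exp (x / 2) * S (m * Real.exp (x - a))) * (Real.exp (x / 2) * T (m' * Real.exp (x - a))))
      = fun x => (g ∘ f) x * Real.exp (x - a) := by
    funext x
    rw [transportPair_integrand_eq]
    simp only [hg, hf, Function.comp_apply]
    ring
  rw [lhs, key]
  simp only [hg, hf]
  rw [← intervalIntegral.integral_const_mul]
  refine intervalIntegral.integral_congr fun v _ => ?_
  ring

/-- On a range starting at the far wall `x₀ = −a` the lower `v`-endpoint is `e^{−2a} = 1/μ`. -/
theorem integral_transportPair_window (S T : ℝ → ℝ) (a m m' x₁ : ℝ)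
    (hS : ContinuousOn (fun v => S (m * v)) (uIcc (Real.exp (-(2 * a))) (Real.exp (x₁ - a))))
    (hT : ContinuousOn (fun v => T (m' * v)) (uIcc (Real.exp (-(2 * a))) (Real.exp (x₁ - a)))) :
    ∫ x in (-a)..x₁, (Real.exp (x / 2) * S (m * Real.exp (x - a))) * (Real.exp (x / 2) * T (m' * Real.exp (x - a)))
      = Real.exp a * ∫ v in (Real.exp (-(2 * a)))..(Real.exp (x₁ - a)), S (m * v) * T (m' * v) := by
  have h0 : Real.exp (-a - a) = Real.exp (-(2 * a)) := by ring_nf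
  have := integral_transportPair S T a m m' (-a) x₁ (by rwa [h0]) (by rwa [h0])
  rwa [h0] at this

/-- THE GRAM FORM OF THE LADDER: summing the pair integrals over the dilates `m, m′ ∈ [1, M]` on a common range `[-a, x₁]`,
`Σ_{m,m′} ∫_{-a}^{x₁} 𝓔_m S · 𝓔_{m′} T dx = e^{a} Σ_{m,m′} ∫_{e^{−2a}}^{e^{x₁−a}} S(mv) T(m′v) dv`
(for `S`, `T` continuous on `[0, ∞)`, so that every dilate is continuous on the range; a seed's cut-off at `v = 1` is part of `S`). -/
theorem transportGram_sum (S T : ℝ → ℝ) (hS : Continuous S) (hT : Continuous T) (a x₁ : ℝ) (M : ℕ) :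
    ∑ m ∈ Icc 1 M, ∑ m' ∈ Icc 1 M, ∫ x in (-a)..x₁,
        (Real.exp (x / 2) * S (m * Real.exp (x - a))) * (Real.exp (x / 2) * T (m' * Real.exp (x - a)))
      = Real.exp a * ∑ m ∈ Icc 1 M, ∑ m' ∈ Icc 1 M,
          ∫ v in (Real.exp (-(2 * a)))..(Real.exp (x₁ - a)), S (m * v) * T (m' * v) := by
  rw [Finset.mul_sum]
  refine Finset.sum_congr rfl fun m _ => ?_
  rw [Finset.mul_sum]
  refine Finset.sum_congr rfl fun m' _ => ?_
  exact integral_transportPair_window S T a m m' x₁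
    ((hS.comp (continuous_const.mul continuous_id)).continuousOn)
    ((hT.comp (continuous_const.mul continuous_id)).continuousOn)

end Summit.RiemannHypothesis.RiemannHypothesis.Theorems.WeilTransportGram

end
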